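import Summits.QuantumFields.YangMills.Theorems.F4SubCurvatureDoorShortRootRigidityHermitianSliceRegistered
import Summits.QuantumFields.YangMills.Theorems.F4SubCurvatureDoorShortRootRigidityHermitianThreeModeLaurent
import Summits.QuantumFields.YangMills.Theorems.F4SubCurvatureDoorShortRootRigidityHermitianCone
import Mathlib
import HarnessLib

/-!
# Rungs R1 «HERMITIAN CONE» and R3 «THREE-MODE LAURENT» of SUB-LINE g22-A «HERMITIAN SLICE», BY NAME
# (planner ym-idea-3 g22/g23; crux ⟨stmt-QuantumFields-23035⟩ `F4SubCurvatureDoor.ShortRootRigidity`, registered stub `:146 stub_oddModeRigidity`;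
# typed rungs `Cruxes/ShortRootRigidity/Lines/hermitian_slice_rungs.lean` fdd8f4dcefd5)

Free-hands work of the EXTRA WIDTH seat ym-line-sfw-p2-w4 (gen 25).  Bookkeeping only: the CONTENT is in
✓`…HermitianThreeModeLaurent` (`threeModeLaurent_unfolded`, p731762) and ✓`…HermitianCone` (`hermitianCone_unfolded`, p732292); the rung
Props `ThreeModeLaurent`, `HermitianCone` (character-identical with the rungs file) and the proved composition
`hermitianPlanarRigidity_of_rungs : R1 → R2 → R3 → R4 → HermitianPlanarRigidity` are in ✓`…HermitianSliceRegistered` (p732632).  This file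
closes R1 and R3 BY NAME by the bare terms and records the reduced composition `hermitianPlanarRigidity_of_R2_R4`: H2 follows from the two
remaining rungs R2 `HermitianAngularRung` and R4 `BoostPositivityKill` alone.
HONEST LABEL: two routine rungs of an INSURANCE sub-line (g22-A, PASS tier B); R2/R4 (the load-bearing ones), H1/H3, `:146`, ⟨23035⟩,
⟨23125⟩ and R2d are OPEN; no crux, ladder rung, leaf or summit is proved; the Yang–Mills mass gap is NOT proved by this.
-/

noncomputable section

namespace Summit.QuantumFields.YangMills.Theorems.F4SubCurvatureDoorHermitianSliceRegistered

/-- ★ **R3 «THREE-MODE LAURENT RIGIDITY» BY NAME.** -/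
theorem threeModeLaurent_holds : ThreeModeLaurent :=
  fun G hG hper hgrowth =>
    Summit.QuantumFields.YangMills.Theorems.F4SubCurvatureDoorHermitianSlice.threeModeLaurent_unfolded G hG hper hgrowth

/-- ★ **R1 «HERMITIAN CONE» BY NAME.** -/
theorem hermitianCone_holds : HermitianCone :=
  fun k μ hk hμ =>
    Summit.QuantumFields.YangMills.Theorems.F4SubCurvatureDoorHermitianCone.hermitianCone_unfolded k μ hk hμ

/-- **H2 from R2 and R4 alone** (R1 and R3 discharged): the reduced composition for the two remaining rungs. -/
theorem hermitianPlanarRigidity_of_R2_R4 (r2 : HermitianAngularRung) (r4 : BoostPositivityKill) : HermitianPlanarRigidity :=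
  hermitianPlanarRigidity_of_rungs hermitianCone_holds r2 threeModeLaurent_holds r4

end Summit.QuantumFields.YangMills.Theorems.F4SubCurvatureDoorHermitianSliceRegistered

end
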